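import Summits.CriticalPhenomena.SAWScalingLimit.Theorems.SAWTotalPositivityCriticalBubbleBoundKestenMSBridgeMass
import Summits.CriticalPhenomena.SAWScalingLimit.Theorems.SAWTotalPositivityCriticalBubbleBoundKestenHWColumnRenewal
import Literature.Probability.LatticeModels.FKIsingRSWSecondMoment
import HarnessLib

/-!
# Averaged anti-concentration of the PINNED renewal density of Kesten's walk (line
`kesten-product-renewal-dictionary`, crux `SAWTotalPositivity.CriticalBubbleBound`, stmt-CriticalPhenomena-7117; lead c5)

The span-sliced companion of Madras–Slade Proposition 8.1.4 (`MS.ms_pinnedBridgeMass_antitone`, sliced by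
LENGTH). Kesten's renewal walk renews at the levels `S_m = X₁ + … + X_m` (spans of the i.i.d. irreducible
bridges) with transversal positions `T_m = Y₁ + … + Y_m`; the critical mass of bridges of span `h` pinned at
transversal level `y`, `u_h(y) := Σ_{W : span W = h, tip W = (h,y)} x_c^{|W|}`, is the Green's function
`P(∃ m, (S_m, T_m) = (h, y))` of the two-dimensional renewal walk (MS (8.1.18)), and `Σ_y u_h(y) = u_h =
columnMass h ≤ 1` is Kesten's bound (B2 of the line). Since every irreducible span is `≥ 1`, `S_m ≥ m`, and the
anti-concentration engine of the c5 programme (sign-averaging + Littlewood–Offord + binomial moment, total mass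
`1` by Kesten's identity, non-degeneracy mass `x_c²`) gives, for every NON-INCREASING `φ : ℕ → [0,∞]` and
every `y`:

* `ms_span_antitone` (word model) / `ms_bridgeSpan_antitone` (the line's `Bridge` objects):
  `Σ_h φ(h) u_h(y) ≤ (√2/x_c) · Σ_m φ(m) (m+1)^{-1/2}`;
* `ms_pinnedColumn_partialSum_le`: `Σ_{h ≤ H} u_h(y) ≤ 2√2 μ √(H+1)` uniformly in `y` — the pinned renewal
  function grows at most like `√H` (the unpinned one, `U(H) = Σ_{h≤H} u_h`, is only known `≤ H+1`;
  conjecturally `U(H) ≍ H^{3/4}`, `u_h(y) ≍ h^{-5/4}`).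

This is the averaged form of the "TipAntiConcentration" half of the open stub B1 (`PinnedLengthMassBound`):
the LENGTH-WEIGHTED pinned mass of B1 escapes this engine because the mean irreducible length is infinite.
Source of the method: N. Madras, G. Slade, *The Self-Avoiding Walk* (1993), §8.1, Prop. 8.1.4 and (8.1.18).
-/

noncomputable section

open Literature.Probability.LatticeModels
open Literature.Probability.RandomPlanarGeometry Literature.Probability.RandomPlanarGeometry.SAW
open Summit.CriticalPhenomena.SAWScalingLimit.Theorems.CriticalBubbleBound.Kesten
open scoped ENNReal NNReal BigOperators
open Classical

namespace Summit.CriticalPhenomena.SAWScalingLimit.Theorems.CriticalBubbleBound.Kesten.MS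

/-- The span of the concatenation of a tuple of words is the sum of their spans. [folklore] -/
theorem ms816_xEnd_flatten_ofFn {m : ℕ} (f : Fin m → List Step) :
    xEnd (List.ofFn f).flatten = ∑ k, xEnd (f k) := by
  simp only [xEnd_eq, ms814_wEnd_flatten_ofFn, Finset.sum_apply]

/-- A concatenation of `m` irreducible bridges has span `≥ m` ("`m` renewals need `m` levels").
[cite: MadrasSlade1993, §8.1, eq. (8.1.18)] -/
theorem ms816_le_xEnd_flatten {m : ℕ} (s : Fin m → {w : List Step // IsIrrBridge w}) :
    (m : ℤ) ≤ xEnd (List.ofFn (fun k => (s k).1)).flatten := by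
  rw [ms816_xEnd_flatten_ofFn]
  calc (m : ℤ) = ∑ _k : Fin m, (1 : ℤ) := by simp
    _ ≤ ∑ k, xEnd ((s k).1) :=
        Finset.sum_le_sum fun k _ => StripMass.one_le_xEnd_of_ne_nil (s k).2.bridge (s k).2.ne_nil

/-- **Span-sliced MS Prop. 8.1.4 (word model)**: for every non-increasing `φ : ℕ → [0,∞]` and every
transversal level `y`, `Σ_{w self-avoiding bridge word, wEnd w 1 = y} φ(span w) x_c^{|w|} ≤ (√2/x_c) Σ_m φ(m)(m+1)^{-1/2}`.
[cite: MadrasSlade1993, Proposition 8.1.4] -/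
theorem ms_span_antitone (φ : ℕ → ℝ≥0∞) (hφ : Antitone φ) (y : ℤ) :
    (∑' w : {w : List Step // IsSAW w ∧ IsBridgeW w ∧ wEnd w 1 = y},
        φ (xEnd w.1).toNat * ENNReal.ofReal (criticalFugacity ^ w.1.length)) ≤
      ENNReal.ofReal (Real.sqrt 2 / criticalFugacity) *
        ∑' m : ℕ, φ m * ENNReal.ofReal (1 / Real.sqrt ((m : ℝ) + 1)) := by
  obtain ⟨hG1, hG2, hG3⟩ := ms_irrFactorisation
  let F : List Step → ℝ≥0∞ := fun w => φ (xEnd w).toNat * ENNReal.ofReal (criticalFugacity ^ w.length)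
  let f : List Step → ℝ≥0∞ := fun w => if IsSAW w ∧ IsBridgeW w ∧ wEnd w 1 = y then F w else 0
  let Φ : (Σ m : ℕ, (Fin m → {w : List Step // IsIrrBridge w})) → List Step :=
    fun x => (List.ofFn (fun k => (x.2 k).1)).flatten
  have step1 : (∑' w : {w : List Step // IsSAW w ∧ IsBridgeW w ∧ wEnd w 1 = y}, F w.1) = ∑' w, f w := by
    have e1 : (∑' w : {w : List Step // IsSAW w ∧ IsBridgeW w ∧ wEnd w 1 = y}, F w.1) =
        ∑' w, ({w | IsSAW w ∧ IsBridgeW w ∧ wEnd w 1 = y} : Set (List Step)).indicator F w :=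
      tsum_subtype ({w | IsSAW w ∧ IsBridgeW w ∧ wEnd w 1 = y} : Set (List Step)) F
    rw [e1]
    refine tsum_congr fun w => ?_
    by_cases hc : IsSAW w ∧ IsBridgeW w ∧ wEnd w 1 = y
    · rw [Set.indicator_of_mem (show w ∈ {w | IsSAW w ∧ IsBridgeW w ∧ wEnd w 1 = y} from hc)]
      exact (if_pos hc).symm
    · rw [Set.indicator_of_notMem (show w ∉ {w | IsSAW w ∧ IsBridgeW w ∧ wEnd w 1 = y} from hc)]
      exact (if_neg hc).symm
  have hsupp : Function.support f ⊆ Set.range Φ := by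
    intro w hw
    rw [Function.mem_support] at hw
    by_cases hc : IsSAW w ∧ IsBridgeW w ∧ wEnd w 1 = y
    · obtain ⟨x, hx⟩ := hG3 w hc.1 hc.2.1
      exact ⟨x, hx⟩
    · exact absurd (if_neg hc) hw
  have step2 : (∑' w, f w) = ∑' m : ℕ, ∑' s : Fin m → {w : List Step // IsIrrBridge w}, f (Φ ⟨m, s⟩) := by
    rw [← hG2.tsum_eq hsupp, ENNReal.tsum_sigma']
  have step3 : ∀ (m : ℕ) (s : Fin m → {w : List Step // IsIrrBridge w}), f (Φ ⟨m, s⟩) ≤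
      φ m * (if (∑ k, wEnd (s k).1 1) = y then ∏ k, ENNReal.ofReal (criticalFugacity ^ ((s k).1).length)
        else 0) := by
    intro m s
    by_cases hc : IsSAW (Φ ⟨m, s⟩) ∧ IsBridgeW (Φ ⟨m, s⟩) ∧ wEnd (Φ ⟨m, s⟩) 1 = y
    · have hy : (∑ k, wEnd (s k).1 1) = y := by
        have := hc.2.2
        rw [show Φ ⟨m, s⟩ = (List.ofFn (fun k => (s k).1)).flatten from rfl,
          ms814_wEnd_flatten_ofFn, Finset.sum_apply] at this
        exact this
      show (if _ then F (Φ ⟨m, s⟩) else 0) ≤ _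
      rw [if_pos hc, if_pos hy]
      show φ (xEnd (List.ofFn (fun k => (s k).1)).flatten).toNat *
          ENNReal.ofReal (criticalFugacity ^ (List.ofFn (fun k => (s k).1)).flatten.length) ≤ _
      rw [ms814_ofReal_pow_flatten]
      refine mul_le_mul' (hφ ?_) le_rfl
      have := ms816_le_xEnd_flatten s
      omega
    · show (if _ then F (Φ ⟨m, s⟩) else 0) ≤ _
      rw [if_neg hc]
      exact zero_le
  have step4 : ∀ m : ℕ, (∑' s : Fin m → {w : List Step // IsIrrBridge w}, f (Φ ⟨m, s⟩)) ≤
      ENNReal.ofReal (Real.sqrt 2 / criticalFugacity) * (φ m * ENNReal.ofReal (1 / Real.sqrt ((m : ℝ) + 1))) := by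
    intro m
    calc (∑' s : Fin m → {w : List Step // IsIrrBridge w}, f (Φ ⟨m, s⟩))
        ≤ ∑' s : Fin m → {w : List Step // IsIrrBridge w}, φ m *
            (if (∑ k, wEnd (s k).1 1) = y then ∏ k, ENNReal.ofReal (criticalFugacity ^ ((s k).1).length)
              else 0) := ENNReal.tsum_le_tsum (step3 m)
      _ = φ m * ∑' s : Fin m → {w : List Step // IsIrrBridge w},
            (if (∑ k, wEnd (s k).1 1) = y then ∏ k, ENNReal.ofReal (criticalFugacity ^ ((s k).1).length)
              else 0) := ENNReal.tsum_mul_left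
      _ ≤ φ m * (ENNReal.ofReal (Real.sqrt 2) *
            ENNReal.ofReal (1 / Real.sqrt (criticalFugacity ^ 2 * (m + 1)))) :=
          mul_le_mul' le_rfl (ms814_anticoncentration m y)
      _ = ENNReal.ofReal (Real.sqrt 2 / criticalFugacity) *
            (φ m * ENNReal.ofReal (1 / Real.sqrt ((m : ℝ) + 1))) := by
          rw [ms814_const]; ring
  calc (∑' w : {w : List Step // IsSAW w ∧ IsBridgeW w ∧ wEnd w 1 = y}, F w.1)
      = ∑' m : ℕ, ∑' s : Fin m → {w : List Step // IsIrrBridge w}, f (Φ ⟨m, s⟩) := step1.trans step2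
    _ ≤ ∑' m : ℕ, ENNReal.ofReal (Real.sqrt 2 / criticalFugacity) *
          (φ m * ENNReal.ofReal (1 / Real.sqrt ((m : ℝ) + 1))) := ENNReal.tsum_le_tsum step4
    _ = _ := ENNReal.tsum_mul_left

/-! ## Transfer to the line's `Bridge` objects -/

/-- For every weight `ψ : ℤ → [0,∞]` of the span, the pinned critical bridge mass of the function model is at
most the corresponding word-model mass (`W ↦ wordOf |W| W.fn` is injective, keeps length, span and tip).
[folklore] -/
theorem ms816_bridge_transfer (ψ : ℤ → ℝ≥0∞) (y : ℤ) :
    (∑' W : Bridge, if W.tip 1 = y then ψ W.span * W.mass else 0) ≤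
      ∑' w : {w : List Step // IsSAW w ∧ IsBridgeW w ∧ wEnd w 1 = y},
        ψ (xEnd w.1) * ENNReal.ofReal (criticalFugacity ^ w.1.length) := by
  -- restrict the left sum to the pinned bridges (the others contribute `0`)
  let P : Set Bridge := {W | W.tip 1 = y}
  let G : {w : List Step // IsSAW w ∧ IsBridgeW w ∧ wEnd w 1 = y} → ℝ≥0∞ :=
    fun w => ψ (xEnd w.1) * ENNReal.ofReal (criticalFugacity ^ w.1.length)
  have hword : ∀ W : Bridge, W.tip 1 = y →
      IsSAW (wordOf W.len W.fn) ∧ IsBridgeW (wordOf W.len W.fn) ∧ wEnd (wordOf W.len W.fn) 1 = y := by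
    intro W hW
    obtain ⟨hs, hb, -⟩ := HW.wordOf_fn_spec W.2.2
    refine ⟨hs, hb, ?_⟩
    rw [← traj_length, length_wordOf, traj_wordOf W.mem_saws_isBridge.1]
    exact hW
  let ι : P → {w : List Step // IsSAW w ∧ IsBridgeW w ∧ wEnd w 1 = y} :=
    fun W => ⟨wordOf W.1.len W.1.fn, hword W.1 W.2⟩
  have hι : Function.Injective ι := by
    rintro ⟨⟨n, ζ, hζ⟩, hW⟩ ⟨⟨n', ζ', hζ'⟩, hW'⟩ hx
    have hw : wordOf n ζ = wordOf n' ζ' := congrArg Subtype.val hx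
    have hn : n = n' := by
      have := congrArg List.length hw
      rwa [length_wordOf, length_wordOf] at this
    subst hn
    have : ζ = ζ' := by
      rw [← traj_wordOf (Zd.mem_bridges.1 hζ).1, hw, traj_wordOf (Zd.mem_bridges.1 hζ').1]
    subst this
    rfl
  have hval : ∀ W : P, G (ι W) = ψ W.1.span * W.1.mass := by
    intro W
    show ψ (xEnd (wordOf W.1.len W.1.fn)) * ENNReal.ofReal (criticalFugacity ^ (wordOf W.1.len W.1.fn).length) = _
    rw [(HW.wordOf_fn_spec W.1.2.2).2.2, length_wordOf]
  calc (∑' W : Bridge, if W.tip 1 = y then ψ W.span * W.mass else 0)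
      = ∑' W : Bridge, P.indicator (fun W => ψ W.span * W.mass) W := by
        refine tsum_congr fun W => ?_
        by_cases hW : W.tip 1 = y
        · rw [if_pos hW, Set.indicator_of_mem (show W ∈ P from hW)]
        · rw [if_neg hW, Set.indicator_of_notMem (show W ∉ P from hW)]
    _ = ∑' W : P, ψ W.1.span * W.1.mass := (tsum_subtype P (fun W => ψ W.span * W.mass)).symm
    _ = ∑' W : P, G (ι W) := tsum_congr fun W => (hval W).symm
    _ ≤ ∑' w, G w := ENNReal.tsum_comp_le_tsum_of_injective hι G

/-- **Span-sliced MS Prop. 8.1.4 for the line's objects**: for every non-increasing `φ : ℕ → [0,∞]` and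
every transversal level `y`, `Σ_{W bridge, tip₂ W = y} φ(span W) x_c^{|W|} ≤ (√2/x_c) Σ_m φ(m)(m+1)^{-1/2}`
— the pinned renewal density `u_h(y)` of Kesten's walk satisfies `Σ_h φ(h) u_h(y) ≤ (√2/x_c) Σ_m φ(m)(m+1)^{-1/2}`.
[cite: MadrasSlade1993, Proposition 8.1.4] -/
theorem ms_bridgeSpan_antitone : ∀ (φ : ℕ → ℝ≥0∞), Antitone φ → ∀ y : ℤ, (∑' W : Bridge, if W.tip 1 = y then φ W.span.toNat * W.mass else 0) ≤ ENNReal.ofReal (Real.sqrt 2 / criticalFugacity) * ∑' m : ℕ, φ m * ENNReal.ofReal (1 / Real.sqrt ((m : ℝ) + 1)) :=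
  fun φ hφ y => (ms816_bridge_transfer (fun z => φ z.toNat) y).trans (ms_span_antitone φ hφ y)

/-- **The pinned renewal function is `O(√H)`**: `Σ_{W bridge, span W ≤ H, tip₂ W = y} x_c^{|W|} ≤ 2√2 μ √(H+1)`
for every `H` and every transversal level `y` (take `φ = 1_{[0,H]}`; `Σ_{m≤H}(m+1)^{-1/2} ≤ 2√(H+1)`).
[cite: MadrasSlade1993, Proposition 8.1.4] -/
theorem ms_pinnedColumn_partialSum_le (H : ℕ) (y : ℤ) :
    (∑' W : Bridge, if W.span ≤ H ∧ W.tip 1 = y then W.mass else 0) ≤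
      ENNReal.ofReal (2 * Real.sqrt 2 * connectiveConstant * Real.sqrt ((H : ℝ) + 1)) := by
  have hx := StripMass.criticalFugacity_pos
  have hμ : 0 < connectiveConstant := by have := hx; rwa [criticalFugacity, inv_pos] at this
  let φ : ℕ → ℝ≥0∞ := fun h => if h ≤ H then 1 else 0
  have hφ : Antitone φ := by
    intro a b hab
    show (if b ≤ H then (1 : ℝ≥0∞) else 0) ≤ if a ≤ H then 1 else 0
    by_cases hb : b ≤ H
    · rw [if_pos hb, if_pos (hab.trans hb)]
    · rw [if_neg hb]; exact zero_le
  have main := ms_bridgeSpan_antitone φ hφ y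
  -- left side: termwise comparison (`span W ≤ H` iff `φ (span W).toNat = 1`, spans are `≥ 0`)
  have hL : (∑' W : Bridge, if W.span ≤ H ∧ W.tip 1 = y then W.mass else 0) ≤
      ∑' W : Bridge, if W.tip 1 = y then φ W.span.toNat * W.mass else 0 := by
    refine ENNReal.tsum_le_tsum fun W => ?_
    by_cases hc : W.span ≤ H ∧ W.tip 1 = y
    · rw [if_pos hc, if_pos hc.2]
      have hs : W.span.toNat ≤ H := by have := W.span_nonneg; omega
      rw [show φ W.span.toNat = 1 from if_pos hs, one_mul]
    · rw [if_neg hc]; exact zero_le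
  -- right side: the finite sum of `1/√(m+1)`
  have hR : (∑' m : ℕ, φ m * ENNReal.ofReal (1 / Real.sqrt ((m : ℝ) + 1))) ≤
      ENNReal.ofReal (2 * Real.sqrt ((H : ℝ) + 1)) := by
    rw [show (∑' m : ℕ, φ m * ENNReal.ofReal (1 / Real.sqrt ((m : ℝ) + 1))) =
        ∑ m ∈ Finset.range (H + 1), φ m * ENNReal.ofReal (1 / Real.sqrt ((m : ℝ) + 1)) from
      tsum_eq_sum fun m hm => by
        rw [Finset.mem_range] at hm
        rw [show φ m = 0 from if_neg (by omega), zero_mul]]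
    calc ∑ m ∈ Finset.range (H + 1), φ m * ENNReal.ofReal (1 / Real.sqrt ((m : ℝ) + 1))
        = ∑ m ∈ Finset.range (H + 1), ENNReal.ofReal (1 / Real.sqrt ((m : ℝ) + 1)) := by
          refine Finset.sum_congr rfl fun m hm => ?_
          rw [Finset.mem_range] at hm
          rw [show φ m = 1 from if_pos (by omega), one_mul]
      _ = ENNReal.ofReal (∑ m ∈ Finset.range (H + 1), 1 / Real.sqrt ((m : ℝ) + 1)) :=
          (ENNReal.ofReal_sum_of_nonneg (fun m _ => by positivity)).symm
      _ ≤ _ := ENNReal.ofReal_le_ofReal (Literature.Probability.LatticeModels.sum_range_one_div_sqrt_le H)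
  refine (hL.trans main).trans ((mul_le_mul' le_rfl hR).trans ?_)
  rw [← ENNReal.ofReal_mul (by positivity)]
  refine ENNReal.ofReal_le_ofReal (le_of_eq ?_)
  rw [show Real.sqrt 2 / criticalFugacity = Real.sqrt 2 * connectiveConstant by
    rw [criticalFugacity, div_inv_eq_mul]]
  ring

end Summit.CriticalPhenomena.SAWScalingLimit.Theorems.CriticalBubbleBound.Kesten.MS

end
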